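import Summits.Ventures.HSemireg.WedgeHankelRecurrenceGaussChebyshevCotangentSum

/-!
# Venture HSemireg — **THE ODD-DENOMINATOR PRODUCTS: `∏_{k=1}^{m} 2cos(kπ∕(2m+1)) = 1`, `∏_{k=1}^{m} 2sin(kπ∕(2m+1)) = √(2m+1)`, hence `∏_{k=1}^{m} cos(kπ∕(2m+1)) = 2^{−m}`,
# `∏_{k=1}^{m} sin(kπ∕(2m+1)) = √(2m+1) ∕ 2^m`, `∏_{k=1}^{m} tan(kπ∕(2m+1)) = √(2m+1)`** — from `S_{2m}(0) = U_{2m}(0) = (−1)^m` on the real factorisation `S_{2m} = ∏_{k=1}^{2m} (X − 2cos(kπ∕(2m+1)))`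
# (N500) and from the sine product `∏_{k=1}^{2m} 2sin(kπ∕(2m+1)) = 2m+1` (N510), folded by the reflection `k ↦ 2m+1−k`

HONEST FRAMING. Part of the Lean index of the computation cell `pub-hsemireg` (seat p10 gen 49, Sunday typer «UNIFORM-IN-n»).  Real polynomial evaluation and trigonometry only (Mathlib
`Polynomial.Chebyshev.S ∕ U`, `Real.sin ∕ cos ∕ tan ∕ sqrt`); no variety, no cohomology theory, no sheaf, no Ext group and no semiregularity map is constructed here; nothing here says that HC / HC_CM /
HC_AV holds; no Literature fact (unproved `Prop`) is declared or used.  Custodian versions as in `WedgeHankelSiegelIdeal` (1/3).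
SOURCES (cited).  I. S. Gradshteyn, I. M. Ryzhik, *Table of Integrals, Series, and Products*, 1.392 (`∏_{k=1}^{m} cos(kπ∕(2m+1)) = 2^{−m}`, `∏_{k=1}^{m} sin(kπ∕(2m+1)) = √(2m+1)∕2^m`); A. M. Yaglom,
I. M. Yaglom, *Challenging Mathematical Problems with Elementary Solutions* II (1967), Problems 139–142 (`∏ tan(kπ∕(2m+1)) = √(2m+1)`); T. J. Rivlin, *The Chebyshev Polynomials* (1974), §1.2.
PROOF TYPED HERE.  N500 `chebyshevS_eq_prod_real (2m)` at `X = 0` with Mathlib `S_comp_two_mul_X` (`S_n(0) = U_n(0)`) and `U_eval_two_mul_zero` gives `∏_{k=1}^{2m} 2cos(kπ∕(2m+1)) = (−1)^m · (−1)^{2m}`;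
the reflection `k ↦ 2m+1−k` (`cos(π − θ) = −cos θ`, `sin(π − θ) = sin θ`, `Finset.prod_range_add ∕ prod_range_reflect`) folds the `2m` factors into `(−1)^m (∏_{k≤m} 2cos)²`, resp. `(∏_{k≤m} 2sin)²`
(N510 `prod_two_mul_sin_eq` at `n = 2m+1`); positivity on `(0, π∕2)` and `Real.sqrt_sq` extract the roots; `tan = sin ∕ cos`.
DEDUP DISCLOSURE (`rg -n 'prod_cos|prod_sin|prod_tan|odd_denominator' Summits Literature`, `lean search`, 2026-09-04): N510–N512 have the `πj∕n`, `πj∕2n`, `(2j+1)π∕4n` products; the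
odd-denominator products below are in neither Mathlib nor the tree; 0 hits for the 8 names below.

WHAT IS IN THE TREE.  N500 `chebyshevS_eq_prod_real`; N510 `prod_two_mul_sin_eq`; Mathlib `S_comp_two_mul_X`, `U_eval_two_mul_zero`, `Real.cos_pi_sub`, `Real.sin_pi_sub`, `Real.tan_eq_sin_div_cos`, `Real.sqrt_sq`.
THIS FILE (namespace `Summit.Ventures.HSemireg.Wedge.HankelOuter` continued; CHAINED on N515; 0 definitions):
* §1281 `chebyshevS_eval_zero_two_mul` (`S_{2m}(0) = (−1)^m`), `angle_odd_denominator_mem` (`0 < kπ∕(2m+1) < π∕2` for `1 ≤ k ≤ m`), `prod_two_mul_cos_odd_denominator_sq`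
  (`∏_{k=1}^{2m} 2cos(kπ∕(2m+1)) = (−1)^m (∏_{k=1}^{m} 2cos)²`), **`prod_two_mul_cos_odd_denominator_eq_one`**, **`prod_cos_odd_denominator_eq`** (`= 1∕2^m`),
  **`prod_two_mul_sin_odd_denominator_eq_sqrt`**, **`prod_sin_odd_denominator_eq`** (`= √(2m+1)∕2^m`), **`prod_tan_odd_denominator_eq_sqrt`** (`= √(2m+1)`).
CAVEATS.  Products over `k ∈ [1, m]` are written over `Finset.range m` with the shift `k + 1`.  Nothing Ext-side.  New names only.
-/

open Module Polynomial
open scoped Matrix Polynomial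

namespace Summit.Ventures.HSemireg.Wedge.HankelOuter

/-! ## §1281. Odd-denominator cosine, sine and tangent products -/

/-- **`S_{2m}(0) = (−1)^m`** (every commutative ring; `S_n(0) = U_n(0)`). [Mathlib `U_eval_two_mul_zero`; this file, §1281] -/
theorem chebyshevS_eval_zero_two_mul {R : Type*} [CommRing R] (m : ℕ) : (Polynomial.Chebyshev.S R (2 * (m : ℤ))).eval 0 = (-1) ^ m := by
  have h := congrArg (Polynomial.eval (0 : R)) (Polynomial.Chebyshev.S_comp_two_mul_X R (2 * (m : ℤ)))
  rw [eval_comp, eval_mul, eval_ofNat, eval_X, mul_zero, Polynomial.Chebyshev.U_eval_two_mul_zero, Int.cast_negOnePow_natCast] at h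
  exact h

/-- `0 < (k+1)π∕(2m+1) < π∕2` for `k < m`. [bookkeeping; this file, §1281] -/
theorem angle_odd_denominator_mem {k m : ℕ} (hk : k < m) : 0 < ((k : ℝ) + 1) * Real.pi / (2 * m + 1) ∧ ((k : ℝ) + 1) * Real.pi / (2 * m + 1) < Real.pi / 2 := by
  refine ⟨by positivity, ?_⟩
  rw [div_lt_div_iff₀ (by positivity) two_pos]
  have : (k : ℝ) + 1 ≤ m := by exact_mod_cast Nat.lt_iff_add_one_le.mp hk
  nlinarith [Real.pi_pos]

/-- **`∏_{k=1}^{2m} 2cos(kπ∕(2m+1)) = (−1)^m · (∏_{k=1}^{m} 2cos(kπ∕(2m+1)))²`** (reflection `k ↦ 2m+1−k`). [this file, §1281] -/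
theorem prod_two_mul_cos_odd_denominator_sq (m : ℕ) :
    ∏ k ∈ Finset.range (2 * m), 2 * Real.cos (((k : ℝ) + 1) * Real.pi / (2 * m + 1)) = (-1) ^ m * (∏ k ∈ Finset.range m, 2 * Real.cos (((k : ℝ) + 1) * Real.pi / (2 * m + 1))) ^ 2 := by
  have hupper : ∏ k ∈ Finset.range m, 2 * Real.cos ((((m + k : ℕ) : ℝ) + 1) * Real.pi / (2 * m + 1)) = (-1) ^ m * ∏ k ∈ Finset.range m, 2 * Real.cos (((k : ℝ) + 1) * Real.pi / (2 * m + 1)) := by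
    rw [← Finset.prod_range_reflect (fun k => 2 * Real.cos ((((m + k : ℕ) : ℝ) + 1) * Real.pi / (2 * m + 1))) m,
      show ((-1 : ℝ) ^ m) = ∏ _k ∈ Finset.range m, (-1 : ℝ) by rw [Finset.prod_const, Finset.card_range], ← Finset.prod_mul_distrib]
    refine Finset.prod_congr rfl fun k hk => ?_
    have hk := Finset.mem_range.mp hk
    have hidx : (((m + (m - 1 - k) : ℕ) : ℝ) + 1) * Real.pi / (2 * m + 1) = Real.pi - ((k : ℝ) + 1) * Real.pi / (2 * m + 1) := by
      rw [Nat.cast_add, Nat.cast_sub (by omega), Nat.cast_sub (Nat.one_le_iff_ne_zero.mpr (by omega)), Nat.cast_one]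
      field_simp
      ring
    rw [hidx, Real.cos_pi_sub]
    ring
  rw [two_mul m, Finset.prod_range_add, hupper]
  ring

/-- **`∏_{k=1}^{m} 2cos(kπ∕(2m+1)) = 1`.** [Gradshteyn–Ryzhik 1.392; this file, §1281] -/
theorem prod_two_mul_cos_odd_denominator_eq_one (m : ℕ) : ∏ k ∈ Finset.range m, 2 * Real.cos (((k : ℝ) + 1) * Real.pi / (2 * m + 1)) = 1 := by
  -- `S_{2m}(0) = ∏_{k<2m} (0 − 2cos((k+1)π/(2m+1))) = ∏ 2cos(…)` (even number of sign changes) `= (−1)^m`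
  have hS := congrArg (Polynomial.eval (0 : ℝ)) (chebyshevS_eq_prod_real (2 * m))
  rw [Nat.cast_mul, Nat.cast_ofNat, chebyshevS_eval_zero_two_mul, eval_prod] at hS
  have hS' : ((-1 : ℝ)) ^ m = ∏ k ∈ Finset.range (2 * m), 2 * Real.cos (((k : ℝ) + 1) * Real.pi / (2 * m + 1)) := by
    rw [hS, ← one_mul (∏ k ∈ Finset.range (2 * m), 2 * Real.cos _), show (1 : ℝ) = ∏ _k ∈ Finset.range (2 * m), (-1 : ℝ) by rw [Finset.prod_const, Finset.card_range, pow_mul, neg_one_sq, one_pow],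
      ← Finset.prod_mul_distrib]
    refine Finset.prod_congr rfl fun k _ => ?_
    rw [eval_sub, eval_X, eval_C, Nat.cast_mul, Nat.cast_ofNat]
    ring
  rw [prod_two_mul_cos_odd_denominator_sq] at hS'
  have hsq : (∏ k ∈ Finset.range m, 2 * Real.cos (((k : ℝ) + 1) * Real.pi / (2 * m + 1))) ^ 2 = 1 := by
    have h1 : ((-1 : ℝ)) ^ m ≠ 0 := pow_ne_zero _ (by norm_num)
    have := mul_left_cancel₀ h1 (hS'.symm.trans (mul_one _).symm)
    exact this
  have hpos : 0 ≤ ∏ k ∈ Finset.range m, 2 * Real.cos (((k : ℝ) + 1) * Real.pi / (2 * m + 1)) :=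
    Finset.prod_nonneg fun k hk => mul_nonneg zero_le_two
      (Real.cos_pos_of_mem_Ioo ⟨by linarith [(angle_odd_denominator_mem (Finset.mem_range.mp hk)).1, Real.pi_pos], (angle_odd_denominator_mem (Finset.mem_range.mp hk)).2⟩).le
  nlinarith [hsq, hpos]

/-- **`∏_{k=1}^{m} cos(kπ∕(2m+1)) = 1 ∕ 2^m`.** [Gradshteyn–Ryzhik 1.392; this file, §1281] -/
theorem prod_cos_odd_denominator_eq (m : ℕ) : ∏ k ∈ Finset.range m, Real.cos (((k : ℝ) + 1) * Real.pi / (2 * m + 1)) = 1 / 2 ^ m := by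
  have h := prod_two_mul_cos_odd_denominator_eq_one m
  rw [Finset.prod_mul_distrib, Finset.prod_const, Finset.card_range] at h
  rw [eq_div_iff (pow_ne_zero _ two_ne_zero), mul_comm]
  exact h

/-- **`∏_{k=1}^{m} 2sin(kπ∕(2m+1)) = √(2m+1)`.** [Gradshteyn–Ryzhik 1.392; this file, §1281] -/
theorem prod_two_mul_sin_odd_denominator_eq_sqrt (m : ℕ) : ∏ k ∈ Finset.range m, 2 * Real.sin (((k : ℝ) + 1) * Real.pi / (2 * m + 1)) = Real.sqrt (2 * m + 1) := by
  have h := prod_two_mul_sin_eq (n := 2 * m + 1) (Nat.succ_ne_zero _)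
  rw [show 2 * m + 1 - 1 = m + m by omega, Finset.prod_range_add] at h
  have hupper : ∏ k ∈ Finset.range m, 2 * Real.sin ((m + k + 1 : ℕ) * (Real.pi / (2 * m + 1 : ℕ))) = ∏ k ∈ Finset.range m, 2 * Real.sin (((k : ℝ) + 1) * Real.pi / (2 * m + 1)) := by
    rw [← Finset.prod_range_reflect (fun k => 2 * Real.sin ((m + k + 1 : ℕ) * (Real.pi / (2 * m + 1 : ℕ)))) m]
    refine Finset.prod_congr rfl fun k hk => ?_
    have hk := Finset.mem_range.mp hk
    have hidx : (((m + (m - 1 - k) + 1 : ℕ)) : ℝ) * (Real.pi / (2 * m + 1 : ℕ)) = Real.pi - ((k : ℝ) + 1) * Real.pi / (2 * m + 1) := by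
      rw [show m + (m - 1 - k) + 1 = 2 * m + 1 - (k + 1) by omega, Nat.cast_sub (by omega)]
      push_cast
      field_simp
    simp only [hidx, Real.sin_pi_sub]
  have hlower : ∏ k ∈ Finset.range m, 2 * Real.sin ((k + 1 : ℕ) * (Real.pi / (2 * m + 1 : ℕ))) = ∏ k ∈ Finset.range m, 2 * Real.sin (((k : ℝ) + 1) * Real.pi / (2 * m + 1)) :=
    Finset.prod_congr rfl fun k _ => by push_cast; ring_nf
  rw [hupper, hlower, ← sq] at h
  have hpos : 0 ≤ ∏ k ∈ Finset.range m, 2 * Real.sin (((k : ℝ) + 1) * Real.pi / (2 * m + 1)) :=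
    Finset.prod_nonneg fun k hk => mul_nonneg zero_le_two
      (Real.sin_pos_of_pos_of_lt_pi (angle_odd_denominator_mem (Finset.mem_range.mp hk)).1 ((angle_odd_denominator_mem (Finset.mem_range.mp hk)).2.trans (by linarith [Real.pi_pos]))).le
  have hs := Real.sqrt_sq hpos
  rw [h] at hs
  push_cast at hs
  exact hs.symm

/-- **`∏_{k=1}^{m} sin(kπ∕(2m+1)) = √(2m+1) ∕ 2^m`.** [Gradshteyn–Ryzhik 1.392; this file, §1281] -/
theorem prod_sin_odd_denominator_eq (m : ℕ) : ∏ k ∈ Finset.range m, Real.sin (((k : ℝ) + 1) * Real.pi / (2 * m + 1)) = Real.sqrt (2 * m + 1) / 2 ^ m := by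
  have h := prod_two_mul_sin_odd_denominator_eq_sqrt m
  rw [Finset.prod_mul_distrib, Finset.prod_const, Finset.card_range] at h
  rw [eq_div_iff (pow_ne_zero _ two_ne_zero), mul_comm]
  exact h

/-- **`∏_{k=1}^{m} tan(kπ∕(2m+1)) = √(2m+1)`.** [Yaglom–Yaglom II.142; this file, §1281] -/
theorem prod_tan_odd_denominator_eq_sqrt (m : ℕ) : ∏ k ∈ Finset.range m, Real.tan (((k : ℝ) + 1) * Real.pi / (2 * m + 1)) = Real.sqrt (2 * m + 1) := by
  simp_rw [Real.tan_eq_sin_div_cos]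
  rw [Finset.prod_div_distrib, prod_sin_odd_denominator_eq, prod_cos_odd_denominator_eq, div_div_div_cancel_right₀ (pow_ne_zero _ two_ne_zero), div_one]

end Summit.Ventures.HSemireg.Wedge.HankelOuter
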